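import Summits.CriticalPhenomena.SAWScalingLimit.Theses.SAWCircleScreening
import Summits.CriticalPhenomena.SAWScalingLimit.Theorems.SubseqIdentification.Negative.ReversalLattice
import Summits.CriticalPhenomena.SAWScalingLimit.Theorems.SubseqIdentification.Negative.ProbabilityRedundant
import Literature.Probability.RandomPlanarGeometry.LoopSpaceMaps
import Literature.Probability.LatticeModels.MeshDomainJordan
import HarnessLib

/-!
# Route `SAWCircleScreening`, item `EndpointCouplingTame` (stmt-CriticalPhenomena-5467):
reduction to one-endpoint couplings at a flat marked point

The tame endpoint-coupling item compares the critical SAW laws along two endpoint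
approximations `(a, b)`, `(a′, b′)` of a Dobrushin domain flat near both marked points. The
route's screening engine (`ScreeningRecursion`, stmt-5468) acts at ONE marked point at a time:
it couples walks with different starts and a common target ("(iii) … same at `pt 1` by exact
reversal of `SAW.law`" in the planner's proof plan). This file supplies, kernel-checked, the
bookkeeping that turns such one-endpoint couplings into the item:

* `isEndpointApprox_cross` — `(a, b)`, `(a′, b′)` endpoint approximations ⇒ so is `(a′, b)`
  (for every Jordan domain `Ω_δ` is eventually a single mesh component,
  `JordanDomain.eventually_forall_mem_meshDomain'`; endpoints are eventually distinct, hence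
  vertices of `Ω_δ`); with the component plumbing `discreteDomainGraph_reachable_of_walk` /
  `discreteDomainGraph_reachable_of_reachable` (a mesh-graph path from a vertex of `Ω_δ` is a
  path of `Ω_δ`);
* `endpointCouplingTame_of_oneEndpoint` — **reduction**: if in every Dobrushin domain flat
  near its first marked point any two approximations with a common target have asymptotically
  `d_LP`-close laws, then `EndpointCouplingTame`; via the intermediate law `law_δ(a′, b)`, exact
  lattice reversibility (`SubseqIdentification.Negative.map_curve_law_swap`,
  `isEndpointApprox_swap`, the swapped domain `MarkedDomain.swap`), invariance of `d_LP` under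
  the isometry `CurveClass.reverse` (`levyProkhorovEDist_map_eq_of_isometry`), and the triangle
  inequality past the junk meshes (`eventually_isProbabilityMeasure_law`).

No new definitions. The one-endpoint hypothesis is stated inline (it is not a registered item;
the theorem is a reduction, credited to nothing).

## References

* G. F. Lawler, O. Schramm, W. Werner, *On the scaling limit of planar self-avoiding walk*,
  Proc. Sympos. Pure Math. 72 (2004), §3.1 (reversal invariance of `μ^{-|ω|}`), §3.4.2
  [LawlerSchrammWerner2004SAW].
* P. Billingsley, *Convergence of Probability Measures*, 2nd ed. (1999), §6 (Prokhorov metric)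
  [Billingsley1999].
-/

noncomputable section

open MeasureTheory Filter Topology Set
open scoped NNReal ENNReal
open Literature.Probability.RandomPlanarGeometry Literature.Probability.RandomPlanarGeometry.SAW
open Literature.Probability.LatticeModels

namespace Summit.CriticalPhenomena.SAWScalingLimit.Theorems

open Summit.CriticalPhenomena.SAWScalingLimit.Theses.SAWCircleScreening

/-! ### §1 Mesh components and the discrete domain `Ω_δ` -/

section Patch

variable {Ω : Set ℂ} {δ : ℝ}

/-- The discrete domain `Ω_δ` is a union of connected components of the mesh vertex graph: a
mesh vertex joined inside the mesh vertex graph to a vertex of `Ω_δ` is itself in `Ω_δ`.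
[folklore] -/
theorem mem_meshDomain_of_reachable {x y : Site 2} (hxD : x ∈ meshDomain Ω δ)
    {hx : x ∈ meshVertices Ω δ} {hy : y ∈ meshVertices Ω δ}
    (h : (meshVertexGraph Ω δ).Reachable ⟨x, hx⟩ ⟨y, hy⟩) : y ∈ meshDomain Ω δ := by
  simp only [meshDomain, Set.mem_iUnion, Set.mem_image] at hxD ⊢
  obtain ⟨C, hC, x', hx', hx'x⟩ := hxD
  refine ⟨C, hC, ⟨y, hy⟩, ?_, rfl⟩
  have hxx' : x' = ⟨x, hx⟩ := Subtype.ext hx'x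
  subst hxx'
  rw [SimpleGraph.ConnectedComponent.mem_supp_iff] at hx' ⊢
  rw [← hx']
  exact SimpleGraph.ConnectedComponent.sound h.symm

/-- A walk of the mesh vertex graph starting in `Ω_δ` is a walk of `Ω_δ`. [folklore] -/
theorem discreteDomainGraph_reachable_of_walk :
    ∀ {X Y : meshVertices Ω δ} (_ : (meshVertexGraph Ω δ).Walk X Y),
      X.1 ∈ meshDomain Ω δ → (discreteDomainGraph Ω δ).Reachable X.1 Y.1
  | _, _, SimpleGraph.Walk.nil, _ => SimpleGraph.Reachable.refl _
  | X, _, SimpleGraph.Walk.cons (v := W) hadj p, hX => by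
    have hW : W.1 ∈ meshDomain Ω δ :=
      mem_meshDomain_of_reachable (hx := X.2) (hy := W.2) hX hadj.reachable
    have hadj' : (discreteDomainGraph Ω δ).Adj X.1 W.1 := by
      refine discreteDomainGraph_adj_iff.2 ⟨?_, hX, hW⟩
      simpa only [SimpleGraph.comap_adj, Function.Embedding.subtype_apply] using hadj
    exact hadj'.reachable.trans (discreteDomainGraph_reachable_of_walk p hW)

/-- Joined inside the mesh vertex graph to a vertex of `Ω_δ` ⇒ joined in `Ω_δ`. [folklore] -/
theorem discreteDomainGraph_reachable_of_reachable {x y : Site 2} (hxD : x ∈ meshDomain Ω δ)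
    {hx : x ∈ meshVertices Ω δ} {hy : y ∈ meshVertices Ω δ}
    (h : (meshVertexGraph Ω δ).Reachable ⟨x, hx⟩ ⟨y, hy⟩) :
    (discreteDomainGraph Ω δ).Reachable x y := by
  obtain ⟨p⟩ := h
  exact discreteDomainGraph_reachable_of_walk p hxD

end Patch

/-! ### §2 Crossing two endpoint approximations -/

section Cross

variable {D : DobrushinDomain} {a b a' b' : ℝ → Site 2}

/-- **Crossed endpoint approximations.** If `(a, b)` and `(a′, b′)` are endpoint approximations
of the same Dobrushin domain, so is `(a′, b)`: for every Jordan domain the discrete domain `Ω_δ`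
is a single mesh component for all small `δ` (`JordanDomain.eventually_forall_mem_meshDomain'`,
the tie convention of `meshDomain` is eventually inert), the endpoints are eventually distinct
(their mesh points converge to the distinct marked points), hence vertices of `Ω_δ`, hence joined
in `Ω_δ`. This is what lets a two-endpoint coupling pass through the intermediate law
`law_δ(a′, b)`. [folklore] -/
theorem isEndpointApprox_cross (hab : IsEndpointApprox D a b) (hab' : IsEndpointApprox D a' b') :
    IsEndpointApprox D a' b where
  reachable := by
    -- the endpoints are eventually distinct
    have h01 : D.pt 0 ≠ D.pt 1 := fun h => absurd (D.pt_injective h) (by decide)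
    have hr : 0 < dist (D.pt 0) (D.pt 1) := dist_pos.2 h01
    have hne : ∀ {e f : ℝ → Site 2}, IsEndpointApprox D e f →
        ∀ᶠ δ in 𝓝[>] (0 : ℝ), e δ ≠ f δ := fun {e f} h => by
        filter_upwards [Metric.tendsto_nhds.1 h.tendsto_fst _ (half_pos hr),
          Metric.tendsto_nhds.1 h.tendsto_snd _ (half_pos hr)] with δ ha hb heq
        rw [heq] at ha
        have := dist_triangle_left (D.pt 0) (D.pt 1) (meshPoint δ (f δ))
        linarith
    -- a vertex joined in `Ω_δ` to a different vertex lies in `Ω_δ`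
    have hmem : ∀ {δ : ℝ} {x y : Site 2}, (discreteDomainGraph D.carrier δ).Reachable x y →
        x ≠ y → x ∈ meshDomain D.carrier δ := fun {δ x y} h hxy => by
      obtain ⟨p⟩ := h
      cases p with
      | nil => exact absurd rfl hxy
      | cons hadj _ => exact (discreteDomainGraph_adj_iff.1 hadj).2.1
    filter_upwards [hab.reachable, hab'.reachable, hne hab, hne hab',
      D.eventually_forall_mem_meshDomain' isCompact_empty (Set.empty_subset _)]
      with δ hr₁ hr₂ hn₁ hn₂ hconn
    have ha' : a' δ ∈ meshDomain D.carrier δ := hmem hr₂ hn₂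
    have hb : b δ ∈ meshDomain D.carrier δ := hmem hr₁.symm (Ne.symm hn₁)
    obtain ⟨hx, hy, hreach⟩ := hconn.2 (a' δ) ha' (b δ) hb
    exact discreteDomainGraph_reachable_of_reachable ha' hreach
  tendsto_fst := hab'.tendsto_fst
  tendsto_snd := hab.tendsto_snd

end Cross

/-! ### §3 Two-endpoint coupling from one-endpoint couplings -/

section Reduction

open SubseqIdentification.Negative in
/-- **Reduction of `EndpointCouplingTame` to ONE-ENDPOINT couplings at a flat marked point.**
Suppose that for every Dobrushin domain exactly flat (an open half-disc) near its FIRST marked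
point, any two endpoint approximations with a COMMON target have asymptotically `d_LP`-close
critical SAW laws (hypothesis `H` — the instance of (EC) the screening engine at `pt 0` is
designed to produce). Then `EndpointCouplingTame`: for `D` flat near both marked points and
approximations `(a, b)`, `(a′, b′)`, pass through `law_δ(a′, b)` (an endpoint approximation by
`isEndpointApprox_cross`): `H` at `pt 0` couples `law_δ(a, b)` with `law_δ(a′, b)`; exact lattice
reversibility of the critical SAW law (`map_curve_law_swap`: `law_δ(b, a′) ∘ curve⁻¹` is the
time reversal of `law_δ(a′, b) ∘ curve⁻¹`), invariance of `d_LP` under the isometry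
`CurveClass.reverse`, and `H` in the swapped domain `D.swap = (D; b, a)` (flat near ITS first
marked point `D.pt 1`) couple `law_δ(a′, b)` with `law_δ(a′, b′)`; the triangle inequality for
`d_LP` (laws eventually probability measures) concludes. [folklore] -/
theorem endpointCouplingTame_of_oneEndpoint
    (H : ∀ (D : DobrushinDomain) (a a' b : ℝ → Site 2),
      (∃ (ρ₀ : ℝ) (u₀ : ℂ), 0 < ρ₀ ∧ D.carrier ∩ Metric.ball (D.pt 0) ρ₀ =
        {z | u₀ = 0 ∨ 0 < ((z - D.pt 0) * u₀).im} ∩ Metric.ball (D.pt 0) ρ₀) →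
      IsEndpointApprox D a b → IsEndpointApprox D a' b →
      Tendsto (fun δ ↦ levyProkhorovDist
        ((law D.carrier δ (a δ) (b δ)).map fun γ ↦ γ.curve)
        ((law D.carrier δ (a' δ) (b δ)).map fun γ ↦ γ.curve)) (𝓝[>] (0 : ℝ)) (𝓝 0)) :
    EndpointCouplingTame := by
  intro D a b a' b' hflat hab hab'
  obtain ⟨ρ₀, u₀, u₁, hρ, h0, h1⟩ := hflat
  have hab'b : IsEndpointApprox D a' b := isEndpointApprox_cross hab hab'
  -- `pt 0`: couple the starts
  have T1 := H D a a' b ⟨ρ₀, u₀, hρ, h0⟩ hab hab'b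
  -- `pt 1`: couple the targets, by reversal in the swapped domain
  have hflat1 : D.swap.carrier ∩ Metric.ball (D.swap.pt 0) ρ₀ =
      {z | u₁ = 0 ∨ 0 < ((z - D.swap.pt 0) * u₁).im} ∩ Metric.ball (D.swap.pt 0) ρ₀ := by
    rw [MarkedDomain.carrier_swap, MarkedDomain.pt_swap_zero]
    exact h1
  have T2' := H D.swap b b' a' ⟨ρ₀, u₁, hρ, hflat1⟩ (isEndpointApprox_swap hab'b)
    (isEndpointApprox_swap hab')
  have hrev : ∀ (δ : ℝ) (e f : Site 2),
      (law D.carrier δ f e).map (fun γ ↦ γ.curve) =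
        ((law D.carrier δ e f).map fun γ ↦ γ.curve).map CurveClass.reverse :=
    fun δ e f => map_curve_law_swap
  have hiso : ∀ μ ν : Measure (CurveClass ℂ),
      levyProkhorovDist (μ.map CurveClass.reverse) (ν.map CurveClass.reverse) =
        levyProkhorovDist μ ν := fun μ ν => by
    unfold levyProkhorovDist
    rw [levyProkhorovEDist_map_eq_of_isometry CurveClass.isometry_reverse.lipschitz
      CurveClass.isometry_reverse.lipschitz CurveClass.measurable_reverse
      CurveClass.measurable_reverse CurveClass.reverse_reverse]
  have T2 : Tendsto (fun δ ↦ levyProkhorovDist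
      ((law D.carrier δ (a' δ) (b δ)).map fun γ ↦ γ.curve)
      ((law D.carrier δ (a' δ) (b' δ)).map fun γ ↦ γ.curve)) (𝓝[>] (0 : ℝ)) (𝓝 0) := by
    refine T2'.congr fun δ => ?_
    change levyProkhorovDist ((law D.carrier δ (b δ) (a' δ)).map fun γ ↦ γ.curve)
      ((law D.carrier δ (b' δ) (a' δ)).map fun γ ↦ γ.curve) = _
    rw [hrev δ (a' δ) (b δ), hrev δ (a' δ) (b' δ), hiso]
  -- triangle inequality, past the junk meshes
  have hPa := eventually_isProbabilityMeasure_law hab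
  have hPa'b := eventually_isProbabilityMeasure_law hab'b
  have hPa' := eventually_isProbabilityMeasure_law hab'
  have hsum := T1.add T2
  rw [add_zero] at hsum
  refine squeeze_zero' (Eventually.of_forall fun δ ↦ ENNReal.toReal_nonneg) ?_ hsum
  filter_upwards [hPa, hPa'b, hPa'] with δ h₁ h₂ h₃
  haveI := h₁
  haveI := h₂
  haveI := h₃
  haveI : IsProbabilityMeasure ((law D.carrier δ (a δ) (b δ)).map fun γ ↦ γ.curve) :=
    Measure.isProbabilityMeasure_map (aemeasurable_curve _ _ _ _)
  haveI : IsProbabilityMeasure ((law D.carrier δ (a' δ) (b δ)).map fun γ ↦ γ.curve) :=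
    Measure.isProbabilityMeasure_map (aemeasurable_curve _ _ _ _)
  haveI : IsProbabilityMeasure ((law D.carrier δ (a' δ) (b' δ)).map fun γ ↦ γ.curve) :=
    Measure.isProbabilityMeasure_map (aemeasurable_curve _ _ _ _)
  exact levyProkhorovDist_triangle _ _ _

end Reduction

end Summit.CriticalPhenomena.SAWScalingLimit.Theorems
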